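import Summits.BirchSwinnertonDyer.BirchSwinnertonDyer.Theorems.EisensteinPrimesAnalyticLambdaNonUnitCount
import HarnessLib

/-!
# Route `EisensteinPrimes`, line `mudescent`, cruxes 3/5: the ABSOLUTE analytic `(μ, λ)`-count from a
# congruence with a SUM of two series of distinct `T`-orders — the socket of THEOREM C (composite Kummer
# support, «drop the deepest prime»; helper; THEOREMS ONLY)

Seat `bsd-eis-lam-a` g10 (PROGRAMME PART 1b, ACCEL-LIST (4): ANALYTIC side of
`stub_lambdaCount_offLocus`; items stmt-BirchSwinnertonDyer-19033 / -19035; skeleton owner bsd-eis-ky,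
`Lines/mudescent.lean`). No definition, no named fact, nothing about any particular curve; closes
nothing; moves no label.

WHAT AND WHY (HOME/lam-a-g10/lam-a-MEMO-10.md §3b, THEOREM C). For a type-A étale end `E` of squarefree
conductor whose `E[p]` is ramified at a SET `S = {q₁, …, q_r}` of primes, all of Eisenstein type
(`p ∣ num((q_i − 1)/12)`), THEOREM A's linearity (MEMO-8; kernel `…KummerPlaneLemma`) and THEOREM B⁺
(MEMO-10 §2.4: Mazur 1977 III Cor. (8.5) transferred from level `q_i`) give
`Ḡ_E = Σ_i a_i u_i ρ(𝓛_{q_i}) · ∏_{j≠i}(1 − γ̄_{q_j}) · R̄` in `𝔽_p⟦T⟧` — a SUM of `r` terms whose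
`T`-orders are `o_i + ord R̄`, `o_i = Σ_{j≠i} s_{q_j} + e_{q_i}`. When the minimal order is attained ONCE,
the sum has that order: `μ(E) = 0`, `λ_an(E) = min_i o_i + Σ_{split ℓ∉S} s_ℓ` (THEOREM C; `r = 1` is
THEOREM B′/B″). This file proves what the tree can state DOWNSTREAM of such a congruence, for TWO terms
(every census cell of record in THEOREM C's scope has `#S = 2`, MEMO-10 §3b):

* §1 (`Λ`-algebra): `hasUnitContent_and_order_map_add_of_lt` (order of `A + B` when `ord Ā < ord B̄`),
  `hasUnitContent_and_lam_eq_of_truncCongr_add` — `G ≡ u·(A + B) (mod p, T^K)`, `A` of unit content with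
  `ord_T Ā = a`, `ord_T B̄ > a`, `a < K` ⟹ `μ(G) = 0 ∧ λ(G) = a`; the VALUE-fed form; and the order of
  a product «unit-content series of `λ = e`» × multiplier (`order_map_toZMod_mul_eq`).
* §2 (X2 currency, crux 3): `X2.analyticMuLE_zero_and_analyticLambdaEq_of_truncCongr_add`,
  `…_of_valueCongr_add`: `X2.AnalyticMuLE W p 0 ∧ X2.AnalyticLambdaEq W p a`.
* §3 (X1 currency): the same.

HONEST FRAMING. The congruence hypothesis is what MEMO-10 THEOREM C PROVES ON PAPER (modulo the inputs
of THEOREMS A/B⁺: Mazur 1977, Ribet 1990, Vatsal 2005, Ohta 2014 / Yoo 2023, Raynaud 1974). Nothing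
here asserts it. Pre-registered test: kit j292005 (MEMO-10 §3b).

References: [Mazur1977] III Cor. (8.5); [GreenbergVatsal2000] §1 (9)–(10), §2 Prop. (2.4);
[Washington1997] §7.1–7.2; MEMO-10 §3b.
-/

set_option linter.dupNamespace false
set_option autoImplicit false

noncomputable section

open scoped Classical MatrixGroups ModularForm

open PowerSeries CongruenceSubgroup WeierstrassCurve NumberField IsDedekindDomain
  Literature.NumberTheory.EllipticCurves
  Literature.NumberTheory.EllipticCurves.ModularForms
  Literature.NumberTheory.EllipticCurves.Rank1Residual
  Literature.NumberTheory.EllipticCurves.GreenbergVatsal2000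
  Summit.BirchSwinnertonDyer.Rank1Residual
  Summit.BirchSwinnertonDyer.Rank1Residual.X1.MuLambda
  Summit.BirchSwinnertonDyer.Rank1Residual.X11a
  Summit.BirchSwinnertonDyer.Rank1Residual.Iwasawa
  Summit.BirchSwinnertonDyer.Rank1Residual.X2.EulerFactorAlgebra
  Summit.BirchSwinnertonDyer.Rank1Residual.X2.EulerFactorInvariants
  Summit.BirchSwinnertonDyer.Rank1Residual.X2.GreenbergVatsalAnalyticTransferCore
  Summit.BirchSwinnertonDyer.BirchSwinnertonDyer.Theorems
  Summit.BirchSwinnertonDyer.BirchSwinnertonDyer.Theorems.EisensteinPrimesAnalyticLambdaCongruenceTransfer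
  Summit.BirchSwinnertonDyer.BirchSwinnertonDyer.Theorems.EisensteinPrimesAnalyticLambdaValueCongruence
  Summit.BirchSwinnertonDyer.BirchSwinnertonDyer.Theorems.EisensteinPrimesX2AnalyticLambdaResultantCertificate
  Summit.BirchSwinnertonDyer.BirchSwinnertonDyer.Theorems.EisensteinPrimesAnalyticLambdaAbsoluteCount

namespace Summit.BirchSwinnertonDyer.BirchSwinnertonDyer.Theorems.EisensteinPrimesAnalyticLambdaCompositeCount

variable {p : ℕ} [hp : Fact p.Prime]

/-! ## §1. `Λ`-algebra: a sum of two terms of distinct orders -/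

section Algebra

/-- **Order of a sum with distinct orders.** If `A ∈ Λ` has unit content with `ord_T Ā = a` and
`ord_T B̄ > a` (e.g. `B̄ = 0`), then `A + B` has unit content and `ord_T (A + B)‾ = a` — the mechanism
of THEOREM C («the term of minimal order wins»). [folklore] -/
theorem hasUnitContent_and_order_map_add_of_lt {A B : IwasawaAlgebra p} {a : ℕ}
    (ha : (PowerSeries.map (PadicInt.toZMod (p := p)) A).order = a)
    (hB : (a : ℕ∞) < (PowerSeries.map (PadicInt.toZMod (p := p)) B).order) :
    HasUnitContent (A + B) ∧ (PowerSeries.map (PadicInt.toZMod (p := p)) (A + B)).order = a := by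
  have hne : (PowerSeries.map (PadicInt.toZMod (p := p)) A).order ≠
      (PowerSeries.map (PadicInt.toZMod (p := p)) B).order := by
    rw [ha]; exact ne_of_lt hB
  have hord : (PowerSeries.map (PadicInt.toZMod (p := p)) (A + B)).order = a := by
    rw [map_add, PowerSeries.order_add_of_order_ne _ _ hne, ha]
    exact min_eq_left (le_of_lt hB)
  refine ⟨(hasUnitContent_iff_map_toZMod_ne_zero (A + B)).mpr (fun h0 => ?_), hord⟩
  rw [h0, PowerSeries.order_zero] at hord
  exact (ENat.coe_ne_top a) hord.symm

/-- **Congruence with a two-term sum of distinct orders ⟹ `μ = 0` and `λ = ` the smaller order.** If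
`[T^j]Ḡ = u·[T^j](A + B)‾` in `𝔽_p` for all `j < K`, with `u ≠ 0`, `ord_T Ā = a < ord_T B̄` and
`a < K`, then `G` has unit content and `λ(G) = a` — THEOREM C with two support primes (`A`, `B` the two
raised prime-level terms). [cite: GreenbergVatsal2000, §1 (9)–(10)] [cite: Washington1997, §7.1] -/
theorem hasUnitContent_and_lam_eq_of_truncCongr_add {G A B : IwasawaAlgebra p} {a : ℕ}
    (ha : (PowerSeries.map (PadicInt.toZMod (p := p)) A).order = a)
    (hB : (a : ℕ∞) < (PowerSeries.map (PadicInt.toZMod (p := p)) B).order) {u : ZMod p} (hu : u ≠ 0)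
    {K : ℕ}
    (hcong : ∀ j < K, PowerSeries.coeff j (PowerSeries.map (PadicInt.toZMod (p := p)) G) =
      u * PowerSeries.coeff j (PowerSeries.map (PadicInt.toZMod (p := p)) (A + B)))
    (hK : a < K) : HasUnitContent G ∧ lam G = a := by
  obtain ⟨hAB, hord⟩ := hasUnitContent_and_order_map_add_of_lt ha hB
  have hK' : (PowerSeries.map (PadicInt.toZMod (p := p)) (A + B)).order < K := by
    rw [hord]; exact_mod_cast hK
  obtain ⟨hG, h⟩ := EisensteinPrimesAnalyticLambdaCongruenceTransfer.hasUnitContent_and_order_eq_of_truncCongr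
    hu hcong hAB hK'
  refine ⟨hG, ?_⟩
  have hl := natCast_lam_eq_order_map_toZMod hG
  rw [h, hord] at hl
  exact_mod_cast hl

/-- **The same fed by VALUES at the `p`-power roots of unity** (`G(ζ − 1) ≡ c·(A + B)(ζ − 1) (mod p)`
for all primitive `p^{m+1}`-th roots `ζ`, `m ≥ n₀`, one unit `c ∈ ℤ_p`). [cite: Washington1997, §7.1–7.2, Thm. 7.3] -/
theorem hasUnitContent_and_lam_eq_of_valueCongr_add {G A B : IwasawaAlgebra p} {a : ℕ}
    (ha : (PowerSeries.map (PadicInt.toZMod (p := p)) A).order = a)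
    (hB : (a : ℕ∞) < (PowerSeries.map (PadicInt.toZMod (p := p)) B).order) {c : ℤ_[p]} (hc : IsUnit c)
    {n₀ : ℕ}
    (hval : ∀ m : ℕ, n₀ ≤ m → ∀ ζ : ℂ_[p], IsPrimitiveRoot ζ (p ^ (m + 1)) →
      ‖∑' k, ((algebraMap ℚ_[p] ℂ_[p]).comp (algebraMap ℤ_[p] ℚ_[p]))
          (PowerSeries.coeff k (G - PowerSeries.C c * (A + B))) * (ζ - 1) ^ k‖ ≤ (p : ℝ)⁻¹) :
    HasUnitContent G ∧ lam G = a :=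
  hasUnitContent_and_lam_eq_of_truncCongr_add ha hB
    (EisensteinPrimesAnalyticLambdaValueCongruence.toZMod_ne_zero_of_isUnit hc) (K := a + 1)
    (fun j _ ↦ EisensteinPrimesAnalyticLambdaValueCongruence.forall_coeff_toZMod_eq_of_forall_norm_tsum_le
      hval j) (Nat.lt_succ_self _)

/-- **Order of one term of THEOREM C:** a series `U` of unit content with `λ(U) = e` (Mazur's `ρ(𝓛_q)`:
`e = 0` under (G), `e = e_q` otherwise) times a multiplier `Q` of unit content and reduced order `d`
(the raising factors `∏_{j≠i}(1 − γ_{q_j})·R`) has reduced order `e + d`. [folklore] -/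
theorem order_map_toZMod_mul_eq {U Q : IwasawaAlgebra p} (hU : HasUnitContent U) {e : ℕ}
    (he : lam U = e) {d : ℕ} (hd : (PowerSeries.map (PadicInt.toZMod (p := p)) Q).order = d) :
    (PowerSeries.map (PadicInt.toZMod (p := p)) (U * Q)).order = ((e + d : ℕ) : ℕ∞) := by
  rw [map_mul, PowerSeries.order_mul, ← natCast_lam_eq_order_map_toZMod hU, he, hd, Nat.cast_add]

end Algebra

/-! ## §2. X2 currency (crux 3, multiplicative rows): THEOREM C's socket -/

section X2

variable {W : WeierstrassCurve ℚ} [W.IsElliptic] [W.IsGloballyMinimal]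
  {N : ℕ} [NeZero N] {f : CuspForm (Gamma0 N) 2} {ϖ : ℚ} {L : PowerSeries ℚ_[p]}

/-- **X2: `μ_an(W) = 0` and `λ_an(W) = a` from ONE truncated congruence with a two-term sum of distinct
orders.** Data: `(f, ϖ, L)` the datum of `X2.AnalyticMuLE` / `X2.AnalyticLambdaEq` at `(W, p)` (odd
multiplicative `p`) with an integral model `ι(G) = ϖ·L`; `A, B ∈ Λ` with `ord_T Ā = a < ord_T B̄`
(intended: the two raised prime-level terms of THEOREM C, orders `o₁ + ord R̄ < o₂ + ord R̄`); the
DISPLAYED hypothesis `[T^j]Ḡ = u·[T^j](A + B)‾` for `j < K`, `u ≠ 0`, `a < K`. Conclusion: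
`X2.AnalyticMuLE W p 0 ∧ X2.AnalyticLambdaEq W p a` (trivial zero included).
[cite: Mazur1977, III Cor. (8.5)] [cite: GreenbergVatsal2000, §1 (9)–(10)] [cite: Washington1997, §7.1] -/
theorem X2.analyticMuLE_zero_and_analyticLambdaEq_of_truncCongr_add (hf : IsNewformOf W f)
    (hϖ : (ϖ : ℝ) * W.realPeriodRat = plusPeriod f)
    (hLs : W.HasSplitMultiplicativeReductionAtPrime p → IsSplitMultPAdicLFunctionOf f p L)
    (hLn : ¬ W.HasSplitMultiplicativeReductionAtPrime p → IsMultPAdicLFunctionOf f p (-1) L)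
    {G : IwasawaAlgebra p} (hG : iwasawaToPowerSeries p G = PowerSeries.C ((ϖ : ℚ) : ℚ_[p]) * L)
    {A B : IwasawaAlgebra p} {a : ℕ} (ha : (PowerSeries.map (PadicInt.toZMod (p := p)) A).order = a)
    (hB : (a : ℕ∞) < (PowerSeries.map (PadicInt.toZMod (p := p)) B).order) {u : ZMod p} (hu : u ≠ 0)
    {K : ℕ}
    (hcong : ∀ j < K, PowerSeries.coeff j (PowerSeries.map (PadicInt.toZMod (p := p)) G) =
      u * PowerSeries.coeff j (PowerSeries.map (PadicInt.toZMod (p := p)) (A + B)))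
    (hK : a < K) : X2.AnalyticMuLE W p 0 ∧ X2.AnalyticLambdaEq W p a := by
  obtain ⟨hGu, hlamG⟩ := hasUnitContent_and_lam_eq_of_truncCongr_add ha hB hu hcong hK
  obtain ⟨k, hk⟩ := (hasUnitContent_iff_exists_norm_eq_one G).mp hGu
  rw [EisensteinPrimesX2AnalyticLambdaCertificate.norm_coeff_eq_of_iota_eq hG] at hk
  refine ⟨EisensteinPrimesX2AnalyticLambdaCertificate.analyticMuLE_zero_of_norm_coeff_eq_one hf hϖ
      hLs hLn hk,
    (EisensteinPrimesX2AnalyticLambdaCertificate.analyticLambdaEq_iff_of_datum hf hϖ hLs hLn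
      a).mpr fun G₁ hG₁ ↦ ?_⟩
  rw [iwasawaToPowerSeries_injective p (hG₁.trans hG.symm), hlamG]

/-- **X2, fed by VALUES** (THEOREM C's output currency: one unit `c ∈ ℤ_p` and
`‖(G − C(c)·(A + B))(ζ − 1)‖ ≤ 1/p` at every primitive `p^{m+1}`-th root of unity, `m ≥ n₀`).
Conclusion: `X2.AnalyticMuLE W p 0 ∧ X2.AnalyticLambdaEq W p a`.
[cite: Mazur1977, III Cor. (8.5)] [cite: Washington1997, §7.1–7.2, Thm. 7.3] -/
theorem X2.analyticMuLE_zero_and_analyticLambdaEq_of_valueCongr_add (hf : IsNewformOf W f)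
    (hϖ : (ϖ : ℝ) * W.realPeriodRat = plusPeriod f)
    (hLs : W.HasSplitMultiplicativeReductionAtPrime p → IsSplitMultPAdicLFunctionOf f p L)
    (hLn : ¬ W.HasSplitMultiplicativeReductionAtPrime p → IsMultPAdicLFunctionOf f p (-1) L)
    {G : IwasawaAlgebra p} (hG : iwasawaToPowerSeries p G = PowerSeries.C ((ϖ : ℚ) : ℚ_[p]) * L)
    {A B : IwasawaAlgebra p} {a : ℕ} (ha : (PowerSeries.map (PadicInt.toZMod (p := p)) A).order = a)
    (hB : (a : ℕ∞) < (PowerSeries.map (PadicInt.toZMod (p := p)) B).order) {c : ℤ_[p]}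
    (hc : IsUnit c) {n₀ : ℕ}
    (hval : ∀ m : ℕ, n₀ ≤ m → ∀ ζ : ℂ_[p], IsPrimitiveRoot ζ (p ^ (m + 1)) →
      ‖∑' k, ((algebraMap ℚ_[p] ℂ_[p]).comp (algebraMap ℤ_[p] ℚ_[p]))
          (PowerSeries.coeff k (G - PowerSeries.C c * (A + B))) * (ζ - 1) ^ k‖ ≤ (p : ℝ)⁻¹) :
    X2.AnalyticMuLE W p 0 ∧ X2.AnalyticLambdaEq W p a :=
  X2.analyticMuLE_zero_and_analyticLambdaEq_of_truncCongr_add hf hϖ hLs hLn hG ha hB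
    (EisensteinPrimesAnalyticLambdaValueCongruence.toZMod_ne_zero_of_isUnit hc) (K := a + 1)
    (fun j _ ↦ EisensteinPrimesAnalyticLambdaValueCongruence.forall_coeff_toZMod_eq_of_forall_norm_tsum_le
      hval j) (Nat.lt_succ_self _)

end X2

/-! ## §3. X1 currency (crux 5 / rows A1–A3, good ordinary): the same -/

section X1

variable {W : WeierstrassCurve ℚ} [W.IsElliptic] [W.IsGloballyMinimal] [NeZero (W.conductorNorm ℤ)]
  {f : CuspForm (Gamma0 (W.conductorNorm ℤ)) 2} {ϖ : ℚ}

/-- **X1: `X1.MuPart.AnalyticMuLE W p 0 ∧ X1.ParitySqueeze.AnalyticLambdaEq W p a` from ONE truncated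
congruence with a two-term sum of distinct orders** (good ordinary target; `ι(G) = ϖ·L_p(f, α)`).
[cite: Mazur1977, III Cor. (8.5)] [cite: GreenbergVatsal2000, §1 (9)–(10)] [cite: Washington1997, §7.1] -/
theorem X1.analyticMuLE_zero_and_analyticLambdaEq_of_truncCongr_add (hf : IsNewformOf W f)
    (hϖ : (ϖ : ℝ) * W.realPeriodRat = plusPeriod f) {G : IwasawaAlgebra p}
    (hG : iwasawaToPowerSeries p G =
      PowerSeries.C (ϖ : ℚ_[p]) * padicLFunction f (unitRoot W p : ℚ_[p]))
    {A B : IwasawaAlgebra p} {a : ℕ} (ha : (PowerSeries.map (PadicInt.toZMod (p := p)) A).order = a)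
    (hB : (a : ℕ∞) < (PowerSeries.map (PadicInt.toZMod (p := p)) B).order) {u : ZMod p} (hu : u ≠ 0)
    {K : ℕ}
    (hcong : ∀ j < K, PowerSeries.coeff j (PowerSeries.map (PadicInt.toZMod (p := p)) G) =
      u * PowerSeries.coeff j (PowerSeries.map (PadicInt.toZMod (p := p)) (A + B)))
    (hK : a < K) :
    X1.MuPart.AnalyticMuLE W p 0 ∧ X1.ParitySqueeze.AnalyticLambdaEq W p a := by
  obtain ⟨hGu, hlamG⟩ := hasUnitContent_and_lam_eq_of_truncCongr_add ha hB hu hcong hK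
  obtain ⟨k, hk⟩ := (hasUnitContent_iff_exists_norm_eq_one G).mp hGu
  rw [EisensteinPrimesX2AnalyticLambdaCertificate.norm_coeff_eq_of_iota_eq hG] at hk
  refine ⟨EisensteinPrimesX1AnalyticLambdaCertificate.analyticMuLE_zero_of_norm_coeff_eq_one hf hϖ hk,
    (EisensteinPrimesX1AnalyticLambdaCertificate.analyticLambdaEq_iff_of_datum hf hϖ a).mpr
      fun G₁ hG₁ ↦ ?_⟩
  rw [iwasawaToPowerSeries_injective p (hG₁.trans hG.symm), hlamG]

/-- **X1, fed by VALUES** (`‖(G − C(c)·(A + B))(ζ − 1)‖ ≤ 1/p` at all primitive `p^{m+1}`-th roots of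
unity, `m ≥ n₀`): `X1.MuPart.AnalyticMuLE W p 0 ∧ X1.ParitySqueeze.AnalyticLambdaEq W p a`.
[cite: Mazur1977, III Cor. (8.5)] [cite: Washington1997, §7.1–7.2, Thm. 7.3] -/
theorem X1.analyticMuLE_zero_and_analyticLambdaEq_of_valueCongr_add (hf : IsNewformOf W f)
    (hϖ : (ϖ : ℝ) * W.realPeriodRat = plusPeriod f) {G : IwasawaAlgebra p}
    (hG : iwasawaToPowerSeries p G =
      PowerSeries.C (ϖ : ℚ_[p]) * padicLFunction f (unitRoot W p : ℚ_[p]))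
    {A B : IwasawaAlgebra p} {a : ℕ} (ha : (PowerSeries.map (PadicInt.toZMod (p := p)) A).order = a)
    (hB : (a : ℕ∞) < (PowerSeries.map (PadicInt.toZMod (p := p)) B).order) {c : ℤ_[p]}
    (hc : IsUnit c) {n₀ : ℕ}
    (hval : ∀ m : ℕ, n₀ ≤ m → ∀ ζ : ℂ_[p], IsPrimitiveRoot ζ (p ^ (m + 1)) →
      ‖∑' k, ((algebraMap ℚ_[p] ℂ_[p]).comp (algebraMap ℤ_[p] ℚ_[p]))
          (PowerSeries.coeff k (G - PowerSeries.C c * (A + B))) * (ζ - 1) ^ k‖ ≤ (p : ℝ)⁻¹) :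
    X1.MuPart.AnalyticMuLE W p 0 ∧ X1.ParitySqueeze.AnalyticLambdaEq W p a :=
  X1.analyticMuLE_zero_and_analyticLambdaEq_of_truncCongr_add hf hϖ hG ha hB
    (EisensteinPrimesAnalyticLambdaValueCongruence.toZMod_ne_zero_of_isUnit hc) (K := a + 1)
    (fun j _ ↦ EisensteinPrimesAnalyticLambdaValueCongruence.forall_coeff_toZMod_eq_of_forall_norm_tsum_le
      hval j) (Nat.lt_succ_self _)

end X1

end Summit.BirchSwinnertonDyer.BirchSwinnertonDyer.Theorems.EisensteinPrimesAnalyticLambdaCompositeCount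

end
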